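import Summits.AnomalousDissipation.AnomalousDissipation.Theorems.TwoAndHalfDTwohalfdThesisSobolevCondensateRellichLp
import Summits.AnomalousDissipation.AnomalousDissipation.Theorems.TwoAndHalfDTwohalfdThesisSobolevCondensateCompactness
import Summits.AnomalousDissipation.AnomalousDissipation.Theorems.TwoAndHalfDTwohalfdThesisSobolevCondensateWeakLimitL2
import Summits.AnomalousDissipation.AnomalousDissipation.Theorems.TwoAndHalfDTwohalfdThesisSobolevCondensateLimit
import Summits.AnomalousDissipation.AnomalousDissipation.Theorems.TwoAndHalfDTwohalfdThesisSobolevCondensateContradiction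
import Summits.AnomalousDissipation.AnomalousDissipation.Theorems.TwoAndHalfDTwohalfdNegRegularCondensateRestart
import Summits.AnomalousDissipation.AnomalousDissipation.Theorems.TwoAndHalfDTwohalfdNegRegularCondensateSelection
import Summits.AnomalousDissipation.AnomalousDissipation.Theorems.TwoAndHalfDTwohalfdNegRegularCondensateLevel
import Summits.AnomalousDissipation.AnomalousDissipation.Theorems.TwoAndHalfDTwohalfdNegRegularCondensateWeakLimit
import Summits.AnomalousDissipation.AnomalousDissipation.Theorems.TwoAndHalfDTwohalfdNegCondensate

/-!
# The SOBOLEV-CONDENSATE no-go for the crux `TwoAndHalfD.TwohalfdThesis` (stmt-AnomalousDissipation-0206)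

Line `Sketch` (duhamel-release), lead c7, skeleton section N.  The crux `X = TwohalfdThesis` asks for ONE
steady `x₃`-invariant force and a bounded-energy family of `x₃`-invariant Leray–Hopf solutions with a
`j`-uniform dissipation floor; in the 2½-D class all the anomaly sits in the steadily SOURCED third
component advected by the planar Navier–Stokes flow `v_j`.  The sibling lead 0211-c7 proved the
REGULAR-CONDENSATE theorem (`Theorems.TwohalfdNeg.RegularCondensate.scalarNoAnomaly_of_regularCondensate`):
no anomaly if `v_j` is `limsup`-mean `L²`-asymptotic to comparison flows `W_j` that are uniformly bounded
and uniformly LIPSCHITZ in space–time.  This file frees that theorem from the Lipschitz requirement: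

* `scalarNoAnomaly_of_sobolevCondensate` (planar form).  `g` smooth mean-zero steady force, `h` smooth
  mean-zero steady source; comparison flows `W_j : ℝ × T² → ℝ²` continuous, `‖W_j‖ ≤ B`, weakly divergence
  free at every time, with UNIFORMLY BOUNDED ENSTROPHY `‖∇W_j(t)‖²_{L²} ≤ G` and UNIFORMLY BOUNDED
  `L²`-SPEED `‖W_j(t) − W_j(s)‖_{L²} ≤ B|t − s|`; `ν_j → 0`, `v_j` global Leray–Hopf (planar NS forced by
  `g`), `θ_j` global weak sourced scalars over `v_j` with `ν`-uniformly bounded `limsup`-mean variance,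
  and SOBOLEV CONDENSATION `⟨∫‖v_j − W_j‖²⟩ → 0` ⇒ `⟨ν_j‖∇θ_j‖²⟩ → 0`.  Contains the Lipschitz theorem
  on paper (an `L`-Lipschitz space–time field bounded by `L` is continuous, has `‖∇W(t)‖²_{L²} ≤ 2L²` by
  Rademacher and `L²`-speed `≤ L`) and covers vortex-PATCH-type coherent structures: bounded vorticity
  (log-Lipschitz, not Lipschitz, velocity), drifting and deforming with bounded `L²`-speed, `j`-dependent.
* `twohalfdNeg_family_of_sobolevCondensate` (crux form, Tendsto): the negative crux `TwohalfdNeg`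
  restricted to bounded-energy `x₃`-invariant Leray–Hopf families whose planar velocity so condenses.
* `twohalfdThesis_witness_not_sobolevCondensing` (X's `∃`-language): an `X`-WITNESS (a `j`-uniform
  dissipation floor) keeps a positive `limsup`-mean `L²`-distance from EVERY such comparison family —
  its leading-order planar flow is ENSTROPHY-UNBOUNDED or `L²`-FAST.

PROOF = 0211-c7's block architecture with four modules swapped: RC-AA → Rellich on `L²(T²;ℝ²)` +
Arzelà–Ascoli in `C([0,S]; L²)` (`stub_scRellichLp`, `stub_scCompactness`); RC-WL → + the `L²` upgrade
(`stub_scWeakLimitL2`); RC-LIM → `L²((0,S) × T²)` convergence to a measurable Sobolev drift (`stub_scLimit`);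
RC-CON → the κ = 0 DiPerna–Lions balance for SOBOLEV drifts (`PassiveScalarForcedTransportEnergySobolev`,
p136128; `stub_scContradiction`); RC-SEL/R/LEV/WL/E are 0211-c7's landed stubs, imported by name.
Supports stmt-AnomalousDissipation-0206; closes with the registered tools stub `stub_scCertificate`.
-/

namespace Summit.AnomalousDissipation.AnomalousDissipation.Theorems.TwohalfdThesis.SobolevCondensate

open MeasureTheory Filter Topology Set
open scoped ENNReal NNReal InnerProductSpace
open Literature.Analysis.FunctionSpaces Literature.Analysis.FluidPDE
open Summit.AnomalousDissipation.AnomalousDissipation.Theorems.TwohalfdNeg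
open Summit.AnomalousDissipation.AnomalousDissipation.Theorems.TwohalfdNeg.RegularCondensate

set_option linter.dupNamespace false

/-! ## Small tools -/

/-- Time shifts preserve joint continuity: `(t, x) ↦ W (a + t) x` is continuous if `W` is. [folklore] -/
theorem continuous_uncurry_shift {W : ℝ → UnitAddTorus (Fin 2) → EuclideanSpace ℝ (Fin 2)}
    (hW : Continuous (Function.uncurry W)) (a : ℝ) : Continuous (Function.uncurry fun t => W (a + t)) :=
  hW.comp ((continuous_const.add continuous_fst).prodMk continuous_snd)

/-- Slices of a jointly continuous field are continuous. [folklore] -/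
theorem continuous_slice {W : ℝ → UnitAddTorus (Fin 2) → EuclideanSpace ℝ (Fin 2)}
    (hW : Continuous (Function.uncurry W)) (t : ℝ) : Continuous (W t) :=
  hW.comp (continuous_const.prodMk continuous_id)

/-! ## The planar Sobolev-condensate theorem -/

/-- **The planar Sobolev-condensate theorem.** `g` smooth mean-zero steady force, `h` smooth mean-zero
steady source, comparison flows `W_j` continuous on `ℝ × T²`, bounded by `B`, weakly divergence free at
every time, with enstrophy `‖∇W_j(t)‖²_{L²} ≤ G` and `L²`-speed `‖W_j(t) − W_j(s)‖_{L²} ≤ B|t−s|`;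
`ν_j > 0`, `ν_j → 0`; `v_j` global Leray–Hopf solutions of the planar Navier–Stokes equations forced by `g`
(any `L²` data); `θ_j` global weak solutions of `∂ₜθ + v_j·∇θ = ν_jΔθ + h` from `L²` data with
`ν`-uniformly bounded `limsup`-mean variance; and SOBOLEV CONDENSATION `⟨∫‖v_j − W_j‖²⟩ → 0`.  THEN
`⟨ν_j‖∇θ_j‖²⟩ → 0`.  Block architecture (module docstring). [folklore] -/
theorem scalarNoAnomaly_of_sobolevCondensate :
    ∀ (g : UnitAddTorus (Fin 2) → EuclideanSpace ℝ (Fin 2)) (h : UnitAddTorus (Fin 2) → ℝ) (B : ℝ) (G : ℝ≥0)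
      (W : ℕ → ℝ → UnitAddTorus (Fin 2) → EuclideanSpace ℝ (Fin 2)),
      Torus.IsSmooth g → Torus.HasZeroMean g → Torus.IsSmooth h → Torus.HasZeroMean h →
      (∀ j, Continuous (Function.uncurry (W j))) → (∀ j t x, ‖W j t x‖ ≤ B) →
      (∀ j t, Torus.IsWeaklyDivFree (W j t)) → (∀ j t, Torus.eGradNormSq (W j t) ≤ G) →
      (∀ j s t, eLpNorm (W j t - W j s) 2 volume ≤ ENNReal.ofReal (B * |t - s|)) →
      ∀ (ν : ℕ → ℝ) (v₀ : ℕ → UnitAddTorus (Fin 2) → EuclideanSpace ℝ (Fin 2))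
        (v : ℕ → ℝ → UnitAddTorus (Fin 2) → EuclideanSpace ℝ (Fin 2))
        (θ₀ : ℕ → UnitAddTorus (Fin 2) → ℝ) (θ : ℕ → ℝ → UnitAddTorus (Fin 2) → ℝ),
        (∀ j, 0 < ν j) → Tendsto ν atTop (𝓝 0) →
        (∀ j, Torus.IsGlobalLerayHopf (ν j) (fun _ => g) (v₀ j) (v j)) →
        Tendsto (fun j => longTimeAvgSup (fun t => ∫ x, ‖v j t x - W j t x‖ ^ 2)) atTop (𝓝 0) →
        (∀ j, MemLp (θ₀ j) 2 volume) →
        (∀ j, Torus.IsWeakScalarTransportForced (ν j) (v j) (fun _ => h) (θ₀ j) (θ j)) →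
        (∃ E : ℝ, ∀ j, longTimeAvgSup (fun t => Torus.scalarL2Sq (θ j t)) ≤ E) →
        Tendsto (fun j => longTimeAvgSup (fun t => ν j * (Torus.eScalarGradNormSq (θ j t)).toReal))
          atTop (𝓝 0) := by
  intro g h B G W hgs hgz hhs hhz hWc hWbd hWdiv hWG hWt ν v₀ v θ₀ θ hν hν0 hLH hfluct hθ₀ hθw hEθ
  obtain ⟨E, hE⟩ := hEθ
  by_contra hnt
  -- Step 0: an anomaly floor along a subsequence
  have hD0 : ∀ j, 0 ≤ longTimeAvgSup (fun t => ν j * (Torus.eScalarGradNormSq (θ j t)).toReal) :=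
    fun j => longTimeAvgSup_nonneg fun t => mul_nonneg (hν j).le ENNReal.toReal_nonneg
  have hfreq : ∃ ε : ℝ, 0 < ε ∧ ∃ᶠ j in atTop,
      ε ≤ longTimeAvgSup (fun t => ν j * (Torus.eScalarGradNormSq (θ j t)).toReal) := by
    by_contra hall
    push Not at hall
    apply hnt
    rw [tendsto_order]
    exact ⟨fun b hb => Eventually.of_forall fun j => hb.trans_le (hD0 j), fun b hb => hall b hb⟩
  obtain ⟨ε', hε', hfr⟩ := hfreq
  obtain ⟨φ, hφ, hφε⟩ := extraction_of_frequently_atTop hfr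
  -- Step 1: constants
  set ε : ℝ := ε' / 3 with hε_def
  have hε : 0 < ε := by positivity
  have hE0 : 0 ≤ E :=
    le_trans (longTimeAvgSup_nonneg fun t => integral_nonneg fun _ => sq_nonneg _) (hE 0)
  set Eθ : ℝ := E + 1 with hEθ_def
  have hEθ : 0 < Eθ := by positivity
  have hH0 : 0 ≤ ∫ x, h x ^ 2 := integral_nonneg fun _ => sq_nonneg _
  set lam : ℝ := 64 * (∫ x, h x ^ 2) * Eθ / ε ^ 2 + 4 with hlam_def
  have hlam : 0 < lam := by positivity
  set c : ℝ := ε / 2 with hc_def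
  have hc : 0 < c := by positivity
  set Λ : ℝ := lam * Eθ / 2 with hΛ_def
  have hΛ : 0 ≤ Λ := by positivity
  set S₀ : ℝ := 2 * Λ * (c ^ 2 + 8 * (∫ x, h x ^ 2) * Λ) / c ^ 3 with hS₀_def
  have hS₀ : 0 ≤ S₀ := by positivity
  set S : ℝ := S₀ + 1 with hS_def
  have hS : 0 < S := by positivity
  -- fluctuation tolerances along the subsequence
  have hF0 : ∀ j, 0 ≤ longTimeAvgSup (fun t => ∫ x, ‖v j t x - W j t x‖ ^ 2) := fun j =>
    longTimeAvgSup_nonneg fun t => integral_nonneg fun _ => sq_nonneg _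
  set δ : ℕ → ℝ := fun k => longTimeAvgSup (fun t => ∫ x, ‖v (φ k) t x - W (φ k) t x‖ ^ 2) +
    1 / ((k : ℝ) + 1) with hδ_def
  have hδ0 : ∀ k, 0 < δ k := fun k => add_pos_of_nonneg_of_pos (hF0 _) (by positivity)
  have hδlim : Tendsto δ atTop (𝓝 0) := by
    have h1 : Tendsto (fun k => longTimeAvgSup (fun t => ∫ x, ‖v (φ k) t x - W (φ k) t x‖ ^ 2))
        atTop (𝓝 0) := hfluct.comp hφ.tendsto_atTop
    have h2 := h1.add (tendsto_one_div_add_atTop_nhds_zero_nat (𝕜 := ℝ))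
    rw [add_zero] at h2
    exact h2
  -- block constants
  set Cv : ℝ := lam * Eθ * S with hCv_def
  set Cz : ℝ := lam * Eθ with hCz_def
  set C₁ : ℝ := Cz + (∫ x, h x ^ 2) * S + Cv with hC₁_def
  -- Step 2: at every level, a restart-good selected block
  have hblock : ∀ k, ∃ a : ℝ,
      (MemLp (θ (φ k) a) 2 volume ∧ Torus.IsWeakScalarTransportForced (ν (φ k))
        (fun t => v (φ k) (a + t)) (fun _ => h) (θ (φ k) a) (fun t => θ (φ k) (a + t))) ∧
      0 < a ∧
      ε / 2 * S ≤ ∫ t in Ioc a (a + S), ∫ x, θ (φ k) t x * h x ∧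
      ∫ t in Ioc a (a + S), Torus.scalarL2Sq (θ (φ k) t) ≤ lam * Eθ * S ∧
      ∫ t in Ioc a (a + S), ∫ x, ‖v (φ k) t x - W (φ k) t x‖ ^ 2 ≤ lam * δ k * S ∧
      Torus.scalarL2Sq (θ (φ k) a) ≤ lam * Eθ := by
    intro k
    have hGood := stub_rcRestart (ν (φ k)) (v (φ k)) h (θ₀ (φ k)) (θ (φ k)) hhs (hθ₀ _) (hθw _)
    have hfloor : 2 * ε < longTimeAvgSup
        (fun t => ν (φ k) * (Torus.eScalarGradNormSq (θ (φ k) t)).toReal) := by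
      have := hφε k
      rw [hε_def]
      linarith
    have hvar : longTimeAvgSup (fun t => Torus.scalarL2Sq (θ (φ k) t)) < Eθ := by
      rw [hEθ_def]; linarith [hE (φ k)]
    have hfl : longTimeAvgSup (fun t => ∫ x, ‖v (φ k) t x - W (φ k) t x‖ ^ 2) < δ k := by
      rw [hδ_def]; simp only; linarith [one_div_pos.2 (by positivity : (0 : ℝ) < (k : ℝ) + 1)]
    obtain ⟨a, haG, ha0, hpow, hvm, hfm, hz⟩ := stub_rcSelection (ν (φ k)) g (v₀ (φ k)) (v (φ k))
      (W (φ k)) h (θ₀ (φ k)) (θ (φ k)) _ ε Eθ (δ k) S B (hν _) hgs hgz (hLH _) (hWc _) (hWbd _)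
      hhs hhz (hθ₀ _) (hθw _) hGood hε hS (hδ0 k) hfloor hvar hfl
    exact ⟨a, haG, ha0, hpow, hvm, hfm, hz⟩
  choose a ha using hblock
  -- Step 3: the level packages
  have hlevel := fun k => stub_rcLevel (ν (φ k)) (a k) S B Cv (lam * δ k * S) Cz g (v₀ (φ k))
    (v (φ k)) (W (φ k)) h (θ₀ (φ k)) (θ (φ k)) (hν _) (ha k).2.1 hS hgs hgz (hLH _) (hWc _) (hWbd _)
    hhs (hθ₀ _) (hθw _) (ha k).1.1 (ha k).1.2 (ha k).2.2.2.1 (ha k).2.2.2.2.1 (ha k).2.2.2.2.2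
  -- restarted sequences
  set ϑ : ℕ → ℝ → UnitAddTorus (Fin 2) → ℝ := fun k t => θ (φ k) (a k + t) with hϑ_def
  set ϑ₀ : ℕ → UnitAddTorus (Fin 2) → ℝ := fun k => θ (φ k) (a k) with hϑ₀_def
  set vs : ℕ → ℝ → UnitAddTorus (Fin 2) → EuclideanSpace ℝ (Fin 2) := fun k t => v (φ k) (a k + t)
    with hvs_def
  set Ws : ℕ → ℝ → UnitAddTorus (Fin 2) → EuclideanSpace ℝ (Fin 2) := fun k t => W (φ k) (a k + t)
    with hWs_def
  -- Step 4: compactness of the shifted comparison flows (Rellich + Arzelà–Ascoli in `C([0,S]; L²)`)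
  have hWs_t : ∀ k s t, eLpNorm (Ws k t - Ws k s) 2 volume ≤ ENNReal.ofReal (B * |t - s|) := by
    intro k s t
    have h1 := hWt (φ k) (a k + s) (a k + t)
    rwa [show a k + t - (a k + s) = t - s by ring] at h1
  obtain ⟨φ₁, W', hφ₁, hW'm, hW'ae, hWconv⟩ := stub_scCompactness B S G Ws hS (stub_scRellichLp B G)
    (fun k => continuous_uncurry_shift (hWc (φ k)) (a k)) (fun k t x => hWbd _ _ _)
    (fun k t => hWdiv _ _) (fun k t => hWG _ _) hWs_t
  -- Step 5: joint weak limits along `φ₁`, then the `L²` upgrade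
  obtain ⟨φ₂, Θ, Θ₀, hφ₂, hΘm, hΘi, hΘbd, hΘsl, hΘ₀m, hΘ₀bd, hconv, hconv₀⟩ :=
    stub_rcWeakLimit S Cv Cz C₁ (fun n => ϑ (φ₁ n)) (fun n => ϑ₀ (φ₁ n)) hS
      (fun n => (hlevel (φ₁ n)).2.1) (fun n => (hlevel (φ₁ n)).2.2.1)
      (fun n => (hlevel (φ₁ n)).2.2.2.1) (fun n => (hlevel (φ₁ n)).2.2.2.2.1)
      (fun n => (ha (φ₁ n)).1.1) (fun n => (ha (φ₁ n)).2.2.2.2.2)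
  set ψ : ℕ → ℕ := fun n => φ₁ (φ₂ n) with hψ_def
  have hψ : Tendsto ψ atTop atTop := hφ₁.tendsto_atTop.comp hφ₂.tendsto_atTop
  have hconvL2 := stub_scWeakLimitL2 S Cv (fun n => ϑ (ψ n)) Θ hS
    (fun n => (hlevel (ψ n)).2.1) (fun n => (hlevel (ψ n)).2.2.1) (fun n => (hlevel (ψ n)).2.2.2.1)
    hΘm hΘi hΘbd hconv
  -- Step 6: the limit solves the sourced transport equation with the Sobolev drift `W'`
  have hνlim : Tendsto (fun n => ν (φ (ψ n))) atTop (𝓝 0) :=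
    (hν0.comp hφ.tendsto_atTop).comp hψ
  have hfluct_lim : Tendsto (fun n => ∫⁻ p, ‖vs (ψ n) p.1 p.2 - Ws (ψ n) p.1 p.2‖ₑ ^ 2
      ∂(((volume : Measure ℝ).restrict (Ioo 0 S)).prod volume)) atTop (𝓝 0) := by
    have hup : Tendsto (fun n => ENNReal.ofReal (lam * δ (ψ n) * S)) atTop (𝓝 0) := by
      have h1 : Tendsto (fun n => lam * δ (ψ n) * S) atTop (𝓝 (lam * 0 * S)) :=
        ((hδlim.comp hψ).const_mul lam).mul_const S
      rw [mul_zero, zero_mul] at h1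
      simpa using ENNReal.tendsto_ofReal h1
    exact tendsto_of_tendsto_of_tendsto_of_le_of_le tendsto_const_nhds hup (fun n => zero_le)
      fun n => (hlevel (ψ n)).2.2.2.2.2.1
  have hWconv' : Tendsto (fun n => ∫⁻ p, ‖Ws (ψ n) p.1 p.2 - W' p.1 p.2‖ₑ ^ 2
      ∂(((volume : Measure ℝ).restrict (Ioo 0 S)).prod volume)) atTop (𝓝 0) :=
    hWconv.comp hφ₂.tendsto_atTop
  have hclass : Torus.IsWeakScalarTransportForcedOn S 0 W' (fun _ => h) Θ₀ Θ :=
    stub_scLimit S B Cv C₁ h (fun n => ν (φ (ψ n))) (fun n => vs (ψ n)) (fun n => Ws (ψ n)) W'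
      (fun n => ϑ₀ (ψ n)) (fun n => ϑ (ψ n)) Θ₀ Θ hS hhs hνlim (fun n => (ha (ψ n)).1.1)
      (fun n => (hlevel (ψ n)).1) (fun n => (hlevel (ψ n)).2.2.1) (fun n => (hlevel (ψ n)).2.2.2.1)
      (fun n => continuous_uncurry_shift (hWc (φ (ψ n))) (a (ψ n)))
      (fun n t x => hWbd _ _ _) hfluct_lim hW'm
      (hW'ae.mono fun t ht => ⟨ht.1, ht.2.1, ht.2.2.2⟩) hWconv'
      hΘm hΘi hΘsl hΘ₀m hconvL2 hconv₀
  -- Step 7: power and level of the limit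
  obtain ⟨Ch, hCh⟩ := Torus.exists_forall_norm_le_of_continuous hhs.continuous
  have hpowlim : c * S ≤
      ∫ p, Θ p.1 p.2 * h p.2 ∂(((volume : Measure ℝ).restrict (Ioo 0 S)).prod volume) := by
    have ht := hconv (fun p => h p.2)
      ((hhs.continuous.comp continuous_snd).aestronglyMeasurable) ⟨Ch, fun p => by
        rw [← Real.norm_eq_abs]; exact hCh p.2⟩
    refine ge_of_tendsto ht (Eventually.of_forall fun n => ?_)
    show c * S ≤ ∫ p, ϑ (ψ n) p.1 p.2 * h p.2 ∂(((volume : Measure ℝ).restrict (Ioo 0 S)).prod volume)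
    rw [hc_def, (hlevel (ψ n)).2.2.2.2.2.2]
    exact (ha (ψ n)).2.2.1
  have hlevlim : ∫ p, Θ p.1 p.2 ^ 2 ∂(((volume : Measure ℝ).restrict (Ioo 0 S)).prod volume) ≤
      2 * Λ * S := by
    rw [← show Cv = 2 * Λ * S by rw [hCv_def, hΛ_def]; ring]; exact hΘbd
  -- the Sobolev budget of the limit drift on the block
  have hG' : ∫⁻ t in Ioo 0 S, Torus.eGradNormSq (W' t) ^ (1 / 2 : ℝ) < ⊤ := by
    calc ∫⁻ t in Ioo 0 S, Torus.eGradNormSq (W' t) ^ (1 / 2 : ℝ)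
        ≤ ∫⁻ _ in Ioo 0 S, (G : ℝ≥0∞) ^ (1 / 2 : ℝ) :=
          lintegral_mono_ae (hW'ae.mono fun t ht => ENNReal.rpow_le_rpow ht.2.2.1 (by norm_num))
      _ < ⊤ := by
          rw [setLIntegral_const]
          exact ENNReal.mul_lt_top (ENNReal.rpow_lt_top_of_nonneg (by norm_num) ENNReal.coe_ne_top)
            measure_Ioo_lt_top
  -- Step 8: the endgame bound contradicts the choice of `S`
  have hbound : S ≤ S₀ :=
    stub_scContradiction S c Λ h W' Θ₀ Θ hS hc hΛ hhs hΘ₀m hG' hclass hΘm hΘi hlevlim hpowlim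
  linarith

/-! ## The crux `TwohalfdNeg` on Sobolev-condensing `x₃`-invariant families -/

/-- **The negative crux `TwohalfdNeg` on Sobolev-condensing families.** For an `x₃`-invariant smooth
divergence-free mean-zero steady force `f` on `T³`, comparison flows `W_j` on `ℝ × T²` continuous, bounded
by `B`, weakly divergence free at every time, with enstrophy `≤ G` and `L²`-speed `≤ B`, and a family of
`x₃`-invariant global Leray–Hopf solutions `u_j` of NS_{ν_j}, `ν_j → 0`, arbitrary `L²` data, with
`ν`-uniformly bounded `limsup`-mean energy, WHOSE PLANAR VELOCITY IS `L²`-ASYMPTOTIC TO `W_j` in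
`limsup`-mean — `⟨∫_{T³}‖π_E u_j − W_j(t) ∘ π‖²⟩ → 0` — the mean dissipation tends to `0`.  Reduction S1'
(`ReductionOffZero.stub_reductionOffZero`), Alexakis–Doering S2 (`PlanarNoAnomaly.stub_planarNoAnomaly`) and
the planar theorem (the hypothesis transfers to the planar section because the `limsup` means do not see
`t = 0`). [folklore] -/
theorem twohalfdNeg_family_of_sobolevCondensate :
    ∀ f : UnitAddTorus (Fin 3) → EuclideanSpace ℝ (Fin 3),
      (∀ (s : UnitAddCircle) (x : UnitAddTorus (Fin 3)), f (x + Pi.single (2 : Fin 3) s) = f x) →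
      Torus.IsSmooth f → Torus.IsDivFree f → Torus.HasZeroMean f →
      ∀ (B : ℝ) (G : ℝ≥0) (W : ℕ → ℝ → UnitAddTorus (Fin 2) → EuclideanSpace ℝ (Fin 2)),
        (∀ j, Continuous (Function.uncurry (W j))) → (∀ j t x, ‖W j t x‖ ≤ B) →
        (∀ j t, Torus.IsWeaklyDivFree (W j t)) → (∀ j t, Torus.eGradNormSq (W j t) ≤ G) →
        (∀ j s t, eLpNorm (W j t - W j s) 2 volume ≤ ENNReal.ofReal (B * |t - s|)) →
      ∀ (ν : ℕ → ℝ) (u₀ : ℕ → UnitAddTorus (Fin 3) → EuclideanSpace ℝ (Fin 3))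
        (u : ℕ → ℝ → UnitAddTorus (Fin 3) → EuclideanSpace ℝ (Fin 3)),
        (∀ j, 0 < ν j) → Tendsto ν atTop (𝓝 0) →
        (∀ j, Torus.IsGlobalLerayHopf (ν j) (fun _ => f) (u₀ j) (u j)) →
        (∀ j (t : ℝ) (s : UnitAddCircle) (x : UnitAddTorus (Fin 3)),
          u j t (x + Pi.single (2 : Fin 3) s) = u j t x) →
        (∃ E : ℝ, ∀ j, meanEnergy (u j) ≤ E) →
        Tendsto (fun j => longTimeAvgSup (fun t =>
          ∫ x, ‖Torus.planarProjE (u j t x) - W j t (Torus.planarProj x)‖ ^ 2)) atTop (𝓝 0) →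
        Tendsto (fun j => meanDissipation (ν j) (u j)) atTop (𝓝 0) := by
  intro f hfinv hfs hfd hfz B G W hWc hWbd hWdiv hWG hWt ν u₀ u hν hν0 hLH huinv hE hcond
  obtain ⟨g, h, v₀, v, θ₀, θ, hgs, hgd, hgz, hhs, hhz, -, huv, hvLH, hθ₀, hθw, hEv, hEθ, hsplit⟩ :=
    ReductionOffZero.stub_reductionOffZero f hfinv hfs hfd hfz ν u₀ u hν hLH huinv hE
  have hplanar : Tendsto (fun j => meanDissipation (ν j) (v j)) atTop (𝓝 0) :=
    PlanarNoAnomaly.stub_planarNoAnomaly g hgs hgd hgz ν v₀ v hν hν0 hvLH hEv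
  -- the Sobolev-condensation hypothesis read on the planar flow
  have hcond' : Tendsto (fun j => longTimeAvgSup (fun t => ∫ y, ‖v j t y - W j t y‖ ^ 2))
      atTop (𝓝 0) := by
    refine hcond.congr fun j => ?_
    unfold longTimeAvgSup
    refine limsup_congr ?_
    filter_upwards [eventually_gt_atTop (0 : ℝ)] with T hT
    unfold timeMean
    congr 1
    refine intervalIntegral.integral_congr_ae (Eventually.of_forall fun t ht => ?_)
    rw [Set.uIoc_of_le hT.le] at ht
    rw [huv j t ht.1.ne']
    exact Condensate.integral_norm_sq_planarProjE_twoHalf_sub (θ j t)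
      (((hvLH j) (t + 1) (by linarith [ht.1])).memLp t ⟨ht.1.le, by linarith⟩).1
      (continuous_slice (hWc j) t)
  have hscalar : Tendsto (fun j => longTimeAvgSup
      (fun t => ν j * (Torus.eScalarGradNormSq (θ j t)).toReal)) atTop (𝓝 0) :=
    scalarNoAnomaly_of_sobolevCondensate g h B G W hgs hgz hhs hhz hWc hWbd hWdiv hWG hWt ν v₀ v θ₀ θ
      hν hν0 hvLH hcond' hθ₀ hθw hEθ
  have hsum : Tendsto (fun j => meanDissipation (ν j) (v j) +
      longTimeAvgSup (fun t => ν j * (Torus.eScalarGradNormSq (θ j t)).toReal)) atTop (𝓝 0) := by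
    simpa using hplanar.add hscalar
  exact squeeze_zero (fun j => meanDissipation_nonneg (hν j).le (u j)) hsplit hsum

/-! ## In X's `∃`-language: an X-witness does not condense onto bounded-enstrophy comparison flows -/

/-- **No `X`-witness is Sobolev-condensing.**  If `(f, ν, u₀, u)` carries the crux `TwohalfdThesis` — an
`x₃`-invariant admissible force, `ν_j → 0`, `x₃`-invariant global Leray–Hopf solutions with bounded
`limsup`-mean energy AND a `j`-uniform dissipation floor `ε > 0` — then for EVERY family of continuous,
bounded, weakly divergence-free comparison flows `W_j` with uniformly bounded enstrophy and `L²`-speed,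
the planar velocity does NOT become `L²`-asymptotic to `W_j` in `limsup`-mean: the leading-order planar
flow of an `X`-witness is enstrophy-unbounded or `L²`-fast (contrapositive of
`twohalfdNeg_family_of_sobolevCondensate`). [folklore] -/
theorem twohalfdThesis_witness_not_sobolevCondensing :
    ∀ f : UnitAddTorus (Fin 3) → EuclideanSpace ℝ (Fin 3),
      (∀ (s : UnitAddCircle) (x : UnitAddTorus (Fin 3)), f (x + Pi.single (2 : Fin 3) s) = f x) →
      Torus.IsSmooth f → Torus.IsDivFree f → Torus.HasZeroMean f →
      ∀ (B : ℝ) (G : ℝ≥0) (W : ℕ → ℝ → UnitAddTorus (Fin 2) → EuclideanSpace ℝ (Fin 2)),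
        (∀ j, Continuous (Function.uncurry (W j))) → (∀ j t x, ‖W j t x‖ ≤ B) →
        (∀ j t, Torus.IsWeaklyDivFree (W j t)) → (∀ j t, Torus.eGradNormSq (W j t) ≤ G) →
        (∀ j s t, eLpNorm (W j t - W j s) 2 volume ≤ ENNReal.ofReal (B * |t - s|)) →
      ∀ (ν : ℕ → ℝ) (u₀ : ℕ → UnitAddTorus (Fin 3) → EuclideanSpace ℝ (Fin 3))
        (u : ℕ → ℝ → UnitAddTorus (Fin 3) → EuclideanSpace ℝ (Fin 3)),
        (∀ j, 0 < ν j) → Tendsto ν atTop (𝓝 0) →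
        (∀ j, Torus.IsGlobalLerayHopf (ν j) (fun _ => f) (u₀ j) (u j)) →
        (∀ j (t : ℝ) (s : UnitAddCircle) (x : UnitAddTorus (Fin 3)),
          u j t (x + Pi.single (2 : Fin 3) s) = u j t x) →
        (∃ E : ℝ, ∀ j, meanEnergy (u j) ≤ E) →
        (∃ ε : ℝ, 0 < ε ∧ ∀ j, ε ≤ meanDissipation (ν j) (u j)) →
        ¬ Tendsto (fun j => longTimeAvgSup (fun t =>
          ∫ x, ‖Torus.planarProjE (u j t x) - W j t (Torus.planarProj x)‖ ^ 2)) atTop (𝓝 0) := by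
  intro f hfinv hfs hfd hfz B G W hWc hWbd hWdiv hWG hWt ν u₀ u hν hν0 hLH huinv hE ⟨ε, hε, hεj⟩ hcond
  have ht := twohalfdNeg_family_of_sobolevCondensate f hfinv hfs hfd hfz B G W hWc hWbd hWdiv hWG hWt ν u₀ u
    hν hν0 hLH huinv hE hcond
  obtain ⟨j, hj⟩ := (ht.eventually (gt_mem_nhds hε)).exists
  exact (not_lt.2 (hεj j)) hj

/-- **Registered tools stub `stub_scCertificate`** (skeleton `Lines/Sketch.lean` §N): the planar theorem,
the crux form and the X-language form of the Sobolev-condensate no-go. [folklore] -/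
theorem stub_scCertificate :
    (∀ (g : UnitAddTorus (Fin 2) → EuclideanSpace ℝ (Fin 2)) (h : UnitAddTorus (Fin 2) → ℝ) (B : ℝ) (G : ℝ≥0)
      (W : ℕ → ℝ → UnitAddTorus (Fin 2) → EuclideanSpace ℝ (Fin 2)),
      Torus.IsSmooth g → Torus.HasZeroMean g → Torus.IsSmooth h → Torus.HasZeroMean h →
      (∀ j, Continuous (Function.uncurry (W j))) → (∀ j t x, ‖W j t x‖ ≤ B) →
      (∀ j t, Torus.IsWeaklyDivFree (W j t)) → (∀ j t, Torus.eGradNormSq (W j t) ≤ G) →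
      (∀ j s t, eLpNorm (W j t - W j s) 2 volume ≤ ENNReal.ofReal (B * |t - s|)) →
      ∀ (ν : ℕ → ℝ) (v₀ : ℕ → UnitAddTorus (Fin 2) → EuclideanSpace ℝ (Fin 2))
        (v : ℕ → ℝ → UnitAddTorus (Fin 2) → EuclideanSpace ℝ (Fin 2))
        (θ₀ : ℕ → UnitAddTorus (Fin 2) → ℝ) (θ : ℕ → ℝ → UnitAddTorus (Fin 2) → ℝ),
        (∀ j, 0 < ν j) → Tendsto ν atTop (𝓝 0) →
        (∀ j, Torus.IsGlobalLerayHopf (ν j) (fun _ => g) (v₀ j) (v j)) →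
        Tendsto (fun j => longTimeAvgSup (fun t => ∫ x, ‖v j t x - W j t x‖ ^ 2)) atTop (𝓝 0) →
        (∀ j, MemLp (θ₀ j) 2 volume) →
        (∀ j, Torus.IsWeakScalarTransportForced (ν j) (v j) (fun _ => h) (θ₀ j) (θ j)) →
        (∃ E : ℝ, ∀ j, longTimeAvgSup (fun t => Torus.scalarL2Sq (θ j t)) ≤ E) →
        Tendsto (fun j => longTimeAvgSup (fun t => ν j * (Torus.eScalarGradNormSq (θ j t)).toReal))
          atTop (𝓝 0)) ∧
    (∀ f : UnitAddTorus (Fin 3) → EuclideanSpace ℝ (Fin 3),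
      (∀ (s : UnitAddCircle) (x : UnitAddTorus (Fin 3)), f (x + Pi.single (2 : Fin 3) s) = f x) →
      Torus.IsSmooth f → Torus.IsDivFree f → Torus.HasZeroMean f →
      ∀ (B : ℝ) (G : ℝ≥0) (W : ℕ → ℝ → UnitAddTorus (Fin 2) → EuclideanSpace ℝ (Fin 2)),
        (∀ j, Continuous (Function.uncurry (W j))) → (∀ j t x, ‖W j t x‖ ≤ B) →
        (∀ j t, Torus.IsWeaklyDivFree (W j t)) → (∀ j t, Torus.eGradNormSq (W j t) ≤ G) →
        (∀ j s t, eLpNorm (W j t - W j s) 2 volume ≤ ENNReal.ofReal (B * |t - s|)) →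
      ∀ (ν : ℕ → ℝ) (u₀ : ℕ → UnitAddTorus (Fin 3) → EuclideanSpace ℝ (Fin 3))
        (u : ℕ → ℝ → UnitAddTorus (Fin 3) → EuclideanSpace ℝ (Fin 3)),
        (∀ j, 0 < ν j) → Tendsto ν atTop (𝓝 0) →
        (∀ j, Torus.IsGlobalLerayHopf (ν j) (fun _ => f) (u₀ j) (u j)) →
        (∀ j (t : ℝ) (s : UnitAddCircle) (x : UnitAddTorus (Fin 3)),
          u j t (x + Pi.single (2 : Fin 3) s) = u j t x) →
        (∃ E : ℝ, ∀ j, meanEnergy (u j) ≤ E) →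
        Tendsto (fun j => longTimeAvgSup (fun t =>
          ∫ x, ‖Torus.planarProjE (u j t x) - W j t (Torus.planarProj x)‖ ^ 2)) atTop (𝓝 0) →
        Tendsto (fun j => meanDissipation (ν j) (u j)) atTop (𝓝 0)) ∧
    (∀ f : UnitAddTorus (Fin 3) → EuclideanSpace ℝ (Fin 3),
      (∀ (s : UnitAddCircle) (x : UnitAddTorus (Fin 3)), f (x + Pi.single (2 : Fin 3) s) = f x) →
      Torus.IsSmooth f → Torus.IsDivFree f → Torus.HasZeroMean f →
      ∀ (B : ℝ) (G : ℝ≥0) (W : ℕ → ℝ → UnitAddTorus (Fin 2) → EuclideanSpace ℝ (Fin 2)),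
        (∀ j, Continuous (Function.uncurry (W j))) → (∀ j t x, ‖W j t x‖ ≤ B) →
        (∀ j t, Torus.IsWeaklyDivFree (W j t)) → (∀ j t, Torus.eGradNormSq (W j t) ≤ G) →
        (∀ j s t, eLpNorm (W j t - W j s) 2 volume ≤ ENNReal.ofReal (B * |t - s|)) →
      ∀ (ν : ℕ → ℝ) (u₀ : ℕ → UnitAddTorus (Fin 3) → EuclideanSpace ℝ (Fin 3))
        (u : ℕ → ℝ → UnitAddTorus (Fin 3) → EuclideanSpace ℝ (Fin 3)),
        (∀ j, 0 < ν j) → Tendsto ν atTop (𝓝 0) →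
        (∀ j, Torus.IsGlobalLerayHopf (ν j) (fun _ => f) (u₀ j) (u j)) →
        (∀ j (t : ℝ) (s : UnitAddCircle) (x : UnitAddTorus (Fin 3)),
          u j t (x + Pi.single (2 : Fin 3) s) = u j t x) →
        (∃ E : ℝ, ∀ j, meanEnergy (u j) ≤ E) →
        (∃ ε : ℝ, 0 < ε ∧ ∀ j, ε ≤ meanDissipation (ν j) (u j)) →
        ¬ Tendsto (fun j => longTimeAvgSup (fun t =>
          ∫ x, ‖Torus.planarProjE (u j t x) - W j t (Torus.planarProj x)‖ ^ 2)) atTop (𝓝 0)) :=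
  ⟨scalarNoAnomaly_of_sobolevCondensate, twohalfdNeg_family_of_sobolevCondensate,
    twohalfdThesis_witness_not_sobolevCondensing⟩

end Summit.AnomalousDissipation.AnomalousDissipation.Theorems.TwohalfdThesis.SobolevCondensate
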